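import Summits.QuantumFields.YangMills.Theorems.UnitScaleTiltHalvingCombStepGeometry
import HarnessLib

/-!
# Line H (`BirthV10.stub_halvingStep`, stmt-QuantumFields-19200) — LEMMA B-al-2, brick (B-iv), STEP ESTIMATE FILE 1∕2: bookkeeping and the TWO-BLOCK READINGS of the sectioned
# pair-gauged field against the gauged torus field ([Balaban1985Averaging] (8)∕(11), p.24; [Balaban1987RG1] (0.1)–(0.4))

Cell `ym3-torus` (HUMAN RULING D-0037: YM₃ on T³ is ladder rung R3 — NOT d = 4, NOT infinite volume, NOT a mass gap, NOT the Clay problem), width seat `ym3-torus-px15` gen 4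
(★★OWNER ym3-torus-plan g29 WORD 2026-08-29T04:11:16Z «B-al-2 PENS — ZERO TWINS» (1): px15 = the §3 STEP ESTIMATE on top of ★w3-19200 g10's GEOMETRY HALF
✓`UnitScaleTiltHalvingCombStepGeometry`; LEAD-H ★w5-19200 g7 WORD 20 (3): the B-al (b)-row is the one remaining analytic input of `stub_halvingStep`'s v10).
`--supports stmt-QuantumFields-19200 --as helper`; THEOREMS ONLY (0 `def`, 0 `sorry`); count-neutral; nothing here claims B-al-2, `H42topCrossT`, (M2′), the stub, the crux or the gap.

WHAT.  `π_j = coverAt j : ℤᵈ → T^{(j)}`, `q = Lz`, corner box `Q = [q, bondHi L q κ]` of the `L`-bond `⟨q, q + Le_κ⟩`, coarse bond `ĉ = ⟨π_{j+1} z, κ⟩`.  The block-constant PAIR GAUGE is a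
map `f : T^{(j+1)} → 𝔸ˣ` with `f(π_{j+1} z) = 1`, `f(π_{j+1}(z+e_κ)) = g := axialFn C (Lz) (L(z+e_κ))`, `f ⊂ U1`, read on `T^{(j)}` as `ṽ = f ∘ blockOf` and on `ℤᵈ` as
`v = f ∘ blockOf ∘ π_j`; the SECTIONED torus field is `S(b̂) = (v•C)(sec_q b̂₋, dir b̂)` (w3's ✓`coverAt_sec`), the gauged torus field `W = ṽ•D`.
* §1 `l1_bondHi_sub` (`|bondHi L q κ − q|₁ = d(L−1) + L`), `window_of_inBox` (`Q ⊂ [q, q + N_j)`), `tgt_coverAt`, `update_mem_U1`,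
  the letter-free real bookkeeping `step_arith` ∕ `windows_arith` of the step, `pairGauge_block` ∕ `pairGauge_corner` (`v` is block-constant).
* §2 `norm_pairGauge_sub_one_le` — every bond of `v•C` in `Q` is `δc·p`-small, `δc = (2dL+1)(d(L−1)+L)` (✓(B-i) ✓`HalvingCombPairGauge.norm_gaugeAct_pairGauge_sub_one_le`);
  `box_reading` — `S ∘ π_j = v•C` on `Q` (w3's ✓`sec_coverAt`); ★ `twoBlock_readings` — on every two-block bond `b̂` of `ĉ` (lifted into `Q` by w3's ✓`lift_twoBlock_bond`):
  `‖S b̂ − 1‖ ≤ δc·p`, `‖S b̂ − W b̂‖ ≤ (102∕100)ρ`, `‖W b̂ − 1‖ ≤ δc·p + (102∕100)ρ` from the `ℤᵈ` induction hypothesis `H_j : ‖D(π_j x, μ)⁻¹·C(x, μ) − 1‖ ≤ ρ`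
  (w3's ✓`norm_inv_gaugeActT_mul_gaugeAct_sub_one_le` + ✓`norm_sub_le_of_inv_mul`).
HONEST SCOPE.  Readings only; the STEP estimate is FILE 2∕2 ✓`UnitScaleTiltHalvingCombStep`; the k-level recursion is (B-v).

References: T. Bałaban, CMP **98** (1985) 17–51 [Balaban1985Averaging] ((8)∕(11) p.19, (42) p.23, p.24, (89) p.31); CMP **109** (1987) 249–301 [Balaban1987RG1] ((0.1)–(0.4)
pp.251–253); CMP **102** (1985) 255–275 [Balaban1985UV3] ((27)–(28) p.263).
-/

set_option autoImplicit false

noncomputable section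

open scoped BigOperators Matrix.Norms.L2Operator
open NormedSpace

namespace Summit.QuantumFields.YangMills.Theorems.HalvingCombStepReadings

open Literature.MathematicalPhysics.QuantumFieldTheory.Balaban1983to89
open Literature.MathematicalPhysics.QuantumLattice (blockMap)
open B14DomainGeom (Pt)
open Node00 (coverAt coverAt_apply blockOf_coverAt coverAt_add_e)
open B7Prop1Explicit (e e_apply boxVec axialFn gaugeAct l1 U1 mem_U1 axialFn_mem gaugeAct_mem norm_units_inv_conj_sub_one_le bavg expUnit val_expUnit)
open B7Prop1Local (InBox bondHi AgreeOn)
open B8Lemma1NonAbelian (PlaqSmall)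
open B10Eq27TorusAxialLog (gaugeActT gaugeActT_apply)
open HalvingCombPairGauge (dbavg_gaugeAct_eq_of_blockConst norm_gaugeAct_pairGauge_sub_one_le)
open HalvingCombStepGeometry (coverAt_sec sec_coverAt lift_twoBlock_bond norm_inv_gaugeActT_mul_gaugeAct_sub_one_le norm_sub_le_of_inv_mul blockMap_smul_add_boxVec
  pairGauge_values)

variable {P : Params} {j : ℕ}

/-! ## §1 Bookkeeping -/

section Bookkeeping

/-- The `ℓ¹` size of the corner box of an `L`-bond: `|bondHi L q κ − q|₁ = d·(L−1) + L`. [cite: Balaban1985Averaging, p.24] -/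
theorem l1_bondHi_sub {d L : ℕ} (hL : 1 ≤ L) (q : Pt d) (κ : Fin d) : l1 (bondHi L q κ - q) = d * (L - 1) + L := by
  unfold l1
  have hterm : ∀ i : Fin d, ((bondHi L q κ - q) i).natAbs = (L - 1) + if i = κ then L else 0 := fun i => by
    simp only [Pi.sub_apply, bondHi]
    have hL1 : ((L : ℤ) - 1) = ((L - 1 : ℕ) : ℤ) := by omega
    split_ifs <;> omega
  simp_rw [hterm]
  rw [Finset.sum_add_distrib, Finset.sum_const, Finset.card_univ, Fintype.card_fin, smul_eq_mul, Finset.sum_ite_eq' Finset.univ κ, if_pos (Finset.mem_univ κ)]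

/-- A point of the corner box `Q = [Lz, bondHi L (Lz) κ]` lies in the window `[Lz, Lz + N_j)` of the section based at `Lz` (two levels of room: `N_j ≥ 2L²`).
[cite: Balaban1987RG1, (0.1) p.251] -/
theorem window_of_inBox (hj2 : j + 2 ≤ P.m + P.K) (z x : Pt P.d) (κ : Fin P.d) (hx : InBox ((P.L : ℤ) • z) (bondHi P.L ((P.L : ℤ) • z) κ) x) (μ : Fin P.d) :
    0 ≤ x μ - ((P.L : ℤ) • z) μ ∧ x μ - ((P.L : ℤ) • z) μ < (P.sitesPerDir j : ℕ) := by
  have hL2 : 2 ≤ P.L := P.hL.2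
  have hNj : 2 * P.L * P.L ≤ P.sitesPerDir j := by
    unfold Params.sitesPerDir
    have h2 : P.L ^ 2 ≤ P.L ^ (P.m + P.K - j) := Nat.pow_le_pow_right (by omega) (by omega)
    nlinarith [h2, sq (P.L)]
  have hQ := hx μ
  simp only [bondHi, Pi.smul_apply, smul_eq_mul] at hQ ⊢
  have hNj' : ((2 * P.L * P.L : ℕ) : ℤ) ≤ ((P.sitesPerDir j : ℕ) : ℤ) := by exact_mod_cast hNj
  have hL2' : (2 : ℤ) ≤ P.L := by exact_mod_cast hL2
  push_cast at hNj'
  split_ifs at hQ <;> constructor <;> nlinarith [hQ.1, hQ.2]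

/-- The far end of the coarse bond `ĉ = ⟨π_{j+1} z, κ⟩` is `π_{j+1}(z + e_κ)`. [cite: Balaban1987RG1, (0.1) p.251] -/
theorem tgt_coverAt (z : Pt P.d) (κ : Fin P.d) : (⟨coverAt P (j + 1) z, κ⟩ : PBond P (j + 1)).tgt = coverAt P (j + 1) (z + e κ) := by
  rw [PBond.tgt, coverAt_add_e]

variable {𝔸 : Type*} [NormedRing 𝔸] [NormOneClass 𝔸]

/-- The block-constant pair gauge `f = 1[t ↦ g]` is `U1`-valued when `g` is. [folklore] -/
theorem update_mem_U1 {ι : Type*} [DecidableEq ι] (t : ι) {g : 𝔸ˣ} (hg : g ∈ U1 𝔸) (y : ι) : Function.update (fun _ : ι => (1 : 𝔸ˣ)) t g y ∈ U1 𝔸 := by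
  rcases eq_or_ne y t with rfl | h
  · rw [Function.update_self]; exact hg
  · rw [Function.update_of_ne h]; exact (U1 𝔸).one_mem

/-- **LETTER-FREE BOOKKEEPING OF THE STEP.**  With `ℓ = (d+2)L ≥ L, 2m`, `δ = δc·p`, the windows `10⁴ℓ(δ + 2ρ) ≤ 1` and `C₂·(2Lδ) ≤ 1` (i.e. `L·2δ ≤ c₄ = C₂⁻¹`): the
readings `a₁ ≤ 2(ℓ + L + 2m)·(102∕100)ρ` (✓(B-iii)) and `a₂ ≤ exp(2a′ + r₂)·r₂` (exp-closing of ✓B-al-1, `a′ ≤ 2(Lδ + 3800ℓ²δ²)`,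
`r₂ = (C₂ + 40000(d+2)²)(L·2δ)²`) compose to `a₁ + a₂ + a₁a₂ ≤ (11∕10)·2(ℓ + L + 2m)·ρ + 5·(C₂ + 40000(d+2)²)·(Lδ)²`. [folklore] -/
theorem step_arith {ℓ L m dd δ ρ C a₁ a₂ a' r₂ : ℝ} (hℓ1 : 1 ≤ ℓ) (hLℓ : L ≤ ℓ) (hL0 : 0 ≤ L) (hmℓ : 2 * m ≤ ℓ) (hdd : 0 ≤ dd) (hddL : dd * L ≤ ℓ)
    (hδ0 : 0 ≤ δ) (hρ0 : 0 ≤ ρ) (hC0 : 0 ≤ C) (hwin : 10000 * ℓ * (δ + 2 * ρ) ≤ 1) (hC : C * (2 * L * δ) ≤ 1)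
    (hr₂ : r₂ = (C + 40000 * dd ^ 2) * (L * (2 * δ)) ^ 2) (ha' : a' ≤ 2 * (L * δ + 3800 * ℓ ^ 2 * δ ^ 2)) (ha'0 : 0 ≤ a')
    (ha₁ : a₁ ≤ 2 * (ℓ + L + 2 * m) * (102 / 100 * ρ)) (ha₁0 : 0 ≤ a₁) (ha₂ : a₂ ≤ Real.exp (2 * a' + r₂) * r₂) (ha₂0 : 0 ≤ a₂) :
    a₁ + a₂ + a₁ * a₂ ≤ 11 / 10 * (2 * (ℓ + L + 2 * m)) * ρ + 5 * (C + 40000 * dd ^ 2) * (L * δ) ^ 2 := by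
  have hℓ0 : 0 ≤ ℓ := by linarith
  have hℓρ0 : 0 ≤ ℓ * ρ := mul_nonneg hℓ0 hρ0
  have hℓδ0 : 0 ≤ ℓ * δ := mul_nonneg hℓ0 hδ0
  have ew : 10000 * ℓ * (δ + 2 * ρ) = 10000 * (ℓ * δ) + 20000 * (ℓ * ρ) := by ring
  have hw : 10000 * (ℓ * δ) + 20000 * (ℓ * ρ) ≤ 1 := by rw [ew] at hwin; exact hwin
  have hℓδ : ℓ * δ ≤ 1 / 10000 := by linarith
  have hℓρ : ℓ * ρ ≤ 1 / 20000 := by linarith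
  have hLδ0 : 0 ≤ L * δ := mul_nonneg hL0 hδ0
  have hLδ : L * δ ≤ 1 / 10000 := (mul_le_mul_of_nonneg_right hLℓ hδ0).trans hℓδ
  have hℓδ2 : ℓ ^ 2 * δ ^ 2 ≤ 1 / 10000 * (1 / 10000) := by
    have e : ℓ ^ 2 * δ ^ 2 = (ℓ * δ) * (ℓ * δ) := by ring
    rw [e]; exact mul_le_mul hℓδ hℓδ hℓδ0 (by norm_num)
  have ha'b : a' ≤ 3 / 10000 := by linarith
  -- `r₂ ≤ 2·10⁻³`
  have hdLδ0 : 0 ≤ dd * L * δ := by positivity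
  have hdLδ : dd * L * δ ≤ 1 / 10000 := by
    have h := mul_le_mul_of_nonneg_right hddL hδ0
    linarith
  have hr₂0 : 0 ≤ r₂ := by rw [hr₂]; positivity
  have hr₂b : r₂ ≤ 2 / 1000 := by
    have e : r₂ = (C * (2 * L * δ)) * (2 * (L * δ)) + 160000 * ((dd * L * δ) * (dd * L * δ)) := by rw [hr₂]; ring
    have h1 : (C * (2 * L * δ)) * (2 * (L * δ)) ≤ 1 * (2 * (L * δ)) := mul_le_mul_of_nonneg_right hC (by positivity)
    have h2 : (dd * L * δ) * (dd * L * δ) ≤ (1 / 10000) * (1 / 10000) := mul_le_mul hdLδ hdLδ hdLδ0 (by norm_num)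
    rw [e]; linarith
  -- `a₁ ≤ 4·10⁻⁴` and `0 ≤ (ℓ + L + 2m)ρ`
  have eA : 2 * (ℓ + L + 2 * m) * (102 / 100 * ρ) = 204 / 100 * (ℓ * ρ) + 204 / 100 * (L * ρ) + 408 / 100 * (m * ρ) := by ring
  rw [eA] at ha₁
  have hLρ : L * ρ ≤ ℓ * ρ := mul_le_mul_of_nonneg_right hLℓ hρ0
  have hmρ : 2 * m * ρ ≤ ℓ * ρ := mul_le_mul_of_nonneg_right hmℓ hρ0
  have ha₁b : a₁ ≤ 4 / 10000 := by linarith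
  -- the exponential factor: `exp(2a′ + r₂) ≤ 1 + 2(2a′ + r₂) ≤ 102∕100`
  have hx0 : 0 ≤ 2 * a' + r₂ := by positivity
  have hx1 : |2 * a' + r₂| ≤ 1 := by rw [abs_of_nonneg hx0]; linarith
  have hexp : Real.exp (2 * a' + r₂) ≤ 102 / 100 := by
    have h := (abs_le.mp (Real.abs_exp_sub_one_le hx1)).2
    rw [abs_of_nonneg hx0] at h
    linarith
  have ha₂b : a₂ ≤ 102 / 100 * r₂ := ha₂.trans (mul_le_mul_of_nonneg_right hexp hr₂0)
  have ha₁a₂ : a₁ * a₂ ≤ 4 / 10000 * (102 / 100 * r₂) := mul_le_mul ha₁b ha₂b ha₂0 (by norm_num)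
  -- assemble: `a₂(1 + a₁) ≤ (5∕4)·r₂ = 5(C + 40000dd²)(Lδ)²`, `a₁ ≤ (102∕100)·A·ρ ≤ (11∕10)·A·ρ`
  have e5 : 5 * (C + 40000 * dd ^ 2) * (L * δ) ^ 2 = 5 / 4 * r₂ := by rw [hr₂]; ring
  have eG : 11 / 10 * (2 * (ℓ + L + 2 * m)) * ρ = 220 / 100 * (ℓ * ρ) + 220 / 100 * (L * ρ) + 440 / 100 * (m * ρ) := by ring
  rw [e5, eG]
  linarith

/-- **THE WINDOWS.**  From `10⁴·ℓ·(δ + 2ρ) ≤ 1` (`ℓ = (d+2)L ≥ 1`, `L ≤ ℓ`): the radii consumed by ✓B-al-1, ✓(B-iii), ✓`norm_dbarAvgU_sub_one_le` and w3's ✓`norm_sub_le_of_inv_mul`. [folklore] -/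
theorem windows_arith {ℓ L δ ρ : ℝ} (hℓ1 : 1 ≤ ℓ) (hLℓ : L ≤ ℓ) (hδ0 : 0 ≤ δ) (hρ0 : 0 ≤ ρ) (hwin : 10000 * ℓ * (δ + 2 * ρ) ≤ 1) :
    δ ≤ 1 / 200 ∧ ρ ≤ 1 / 200 ∧ 200 * ℓ * (2 * δ) ≤ 1 ∧ 48 * ℓ * δ ≤ 1 ∧ 10000 * ℓ * (δ + 102 / 100 * ρ) ≤ 1 ∧
      L * δ + 3800 * ℓ ^ 2 * δ ^ 2 ≤ 1 / 4 := by
  have hℓ0 : 0 ≤ ℓ := by linarith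
  have hℓρ0 : 0 ≤ ℓ * ρ := mul_nonneg hℓ0 hρ0
  have hℓδ0 : 0 ≤ ℓ * δ := mul_nonneg hℓ0 hδ0
  have ew : 10000 * ℓ * (δ + 2 * ρ) = 10000 * (ℓ * δ) + 20000 * (ℓ * ρ) := by ring
  have hw : 10000 * (ℓ * δ) + 20000 * (ℓ * ρ) ≤ 1 := by rw [ew] at hwin; exact hwin
  have hℓδ : ℓ * δ ≤ 1 / 10000 := by linarith
  have hℓρ : ℓ * ρ ≤ 1 / 20000 := by linarith
  have hδ : δ ≤ 1 / 10000 := by have h := mul_le_mul_of_nonneg_right hℓ1 hδ0; linarith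
  have hρ : ρ ≤ 1 / 20000 := by have h := mul_le_mul_of_nonneg_right hℓ1 hρ0; linarith
  have hLδ : L * δ ≤ 1 / 10000 := (mul_le_mul_of_nonneg_right hLℓ hδ0).trans hℓδ
  have hℓδ2 : ℓ ^ 2 * δ ^ 2 ≤ 1 / 10000 * (1 / 10000) := by
    have e : ℓ ^ 2 * δ ^ 2 = (ℓ * δ) * (ℓ * δ) := by ring
    rw [e]; exact mul_le_mul hℓδ hℓδ hℓδ0 (by norm_num)
  have e1 : 200 * ℓ * (2 * δ) = 400 * (ℓ * δ) := by ring
  have e2 : 48 * ℓ * δ = 48 * (ℓ * δ) := by ring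
  have e3 : 10000 * ℓ * (δ + 102 / 100 * ρ) = 10000 * (ℓ * δ) + 10200 * (ℓ * ρ) := by ring
  refine ⟨by linarith, by linarith, by rw [e1]; linarith, by rw [e2]; linarith, by rw [e3]; linarith, by linarith⟩

end Bookkeeping

/-! ## §2 Readings of the sectioned field `S` and the gauged torus field `W = ṽ•D` on the two blocks -/

section Readings

variable {𝔸 : Type*} [NormedRing 𝔸] [NormOneClass 𝔸]

/-- **EVERY BOND OF THE PAIR-GAUGED FIELD IN THE CORNER BOX IS `δc·p`-SMALL** (✓(B-i) with `|bondHi − Lz|₁ = d(L−1)+L`), for a block-constant gauge `v = f ∘ blockOf ∘ π_j` with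
`f(π_{j+1}z) = 1`, `f(ĉ₊) = axialFn C (Lz) (L(z+e_κ))`. [cite: Balaban1985Averaging, p.24; Balaban1985UV3, (27)-(28) p.263] -/
theorem norm_pairGauge_sub_one_le (hj2 : j + 2 ≤ P.m + P.K) (C : Pt P.d → Fin P.d → 𝔸ˣ) (hCU : ∀ x μ, C x μ ∈ U1 𝔸)
    (f : Site P (j + 1) → 𝔸ˣ) (hfU : ∀ y, f y ∈ U1 𝔸) (z : Pt P.d) (κ : Fin P.d)
    (hf0 : f (coverAt P (j + 1) z) = 1) (hf1 : f (coverAt P (j + 1) (z + e κ)) = axialFn C ((P.L : ℤ) • z) ((P.L : ℤ) • (z + e κ)))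
    {p : ℝ} (hp : 0 ≤ p) (hP : PlaqSmall C ((P.L : ℤ) • z) (bondHi P.L ((P.L : ℤ) • z) κ) p)
    (hblk : ∀ (w : Pt P.d) (r : Fin P.d → Fin P.L), axialFn C ((P.L : ℤ) • w) ((P.L : ℤ) • w + boxVec P.L r) = 1)
    (x : Pt P.d) (μ : Fin P.d) (hx : InBox ((P.L : ℤ) • z) (bondHi P.L ((P.L : ℤ) • z) κ) x) (hxe : InBox ((P.L : ℤ) • z) (bondHi P.L ((P.L : ℤ) • z) κ) (x + e μ)) :
    ‖((gaugeAct (fun w => f (blockOf (coverAt P j w))) C x μ : 𝔸ˣ) : 𝔸) - 1‖ ≤ (((2 * (P.d * P.L) + 1) * (P.d * (P.L - 1) + P.L) : ℕ) : ℝ) * p := by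
  have hj : j + 1 ≤ P.m + P.K := by omega
  have hL1 : 1 ≤ P.L := by have := P.hL.2; omega
  have hL0 : 0 < P.L := by omega
  have hv : ∀ (w : Pt P.d) (r : Fin P.d → Fin P.L), f (blockOf (coverAt P j ((P.L : ℤ) • w + boxVec P.L r))) = f (coverAt P (j + 1) w) := fun w r => by
    rw [blockOf_coverAt hj, blockMap_smul_add_boxVec hL0]
  have h := norm_gaugeAct_pairGauge_sub_one_le hL1 C hCU (fun w => f (blockOf (coverAt P j w))) (fun w => hfU _) z κ hp hP (hblk z) (hblk (z + e κ))
    (fun r => by simp only [hv, hf0]) (fun r => by simp only [hv, hf1]) x μ hx hxe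
  rw [l1_bondHi_sub hL1] at h
  have e : (2 * ((P.d * P.L : ℕ) : ℝ) + 1) * (((P.d * (P.L - 1) + P.L : ℕ) : ℝ) * p) = (((2 * (P.d * P.L) + 1) * (P.d * (P.L - 1) + P.L) : ℕ) : ℝ) * p := by
    push_cast; ring
  rw [← e]; exact h

omit [NormedRing 𝔸] [NormOneClass 𝔸] in
/-- **BOX READING**: on the corner box the sectioned field IS the pair-gauged field, `S(π_j x, μ) = (v•C)(x, μ)` for `x ∈ Q` (the section reproduces the window, w3's ✓`sec_coverAt`).
[cite: Balaban1987RG1, (0.1) p.251] -/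
theorem box_reading {G : Type*} (hj2 : j + 2 ≤ P.m + P.K) (V : Pt P.d → Fin P.d → G) (z : Pt P.d) (κ : Fin P.d) (x : Pt P.d) (μ : Fin P.d)
    (hx : InBox ((P.L : ℤ) • z) (bondHi P.L ((P.L : ℤ) • z) κ) x) :
    V ((P.L : ℤ) • z + fun ν => (((coverAt P j x) ν - coverAt P j ((P.L : ℤ) • z) ν).val : ℤ)) μ = V x μ := by
  rw [sec_coverAt ((P.L : ℤ) • z) x (window_of_inBox hj2 z x κ hx)]

/-- ★ **TWO-BLOCK READINGS.**  On every torus bond `b̂` with both ends in the two blocks of `ĉ = ⟨π_{j+1} z, κ⟩`: the sectioned field `S(b̂) = (v•C)(sec b̂₋, dir b̂)` is `δc·p`-close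
to `1`, `W(b̂)⁻¹S(b̂)` is `ρ`-close to `1` (`W = ṽ•D`, induction hypothesis `H_j` on `ℤᵈ`), hence `‖S b̂ − W b̂‖ ≤ (102∕100)ρ` and `‖W b̂ − 1‖ ≤ δc·p + (102∕100)ρ`.
[cite: Balaban1987RG1, (0.1)-(0.4) pp.251-253; Balaban1985Averaging, (11) p.19, p.24] -/
theorem twoBlock_readings (hj2 : j + 2 ≤ P.m + P.K) (C : Pt P.d → Fin P.d → 𝔸ˣ) (hCU : ∀ x μ, C x μ ∈ U1 𝔸) (D : GaugeField P j 𝔸ˣ)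
    (f : Site P (j + 1) → 𝔸ˣ) (hfU : ∀ y, f y ∈ U1 𝔸) (z : Pt P.d) (κ : Fin P.d)
    (hf0 : f (coverAt P (j + 1) z) = 1) (hf1 : f (coverAt P (j + 1) (z + e κ)) = axialFn C ((P.L : ℤ) • z) ((P.L : ℤ) • (z + e κ)))
    {p ρ : ℝ} (hp : 0 ≤ p) (hP : PlaqSmall C ((P.L : ℤ) • z) (bondHi P.L ((P.L : ℤ) • z) κ) p)
    (hblk : ∀ (w : Pt P.d) (r : Fin P.d → Fin P.L), axialFn C ((P.L : ℤ) • w) ((P.L : ℤ) • w + boxVec P.L r) = 1)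
    (hH : ∀ (x : Pt P.d) (μ : Fin P.d), ‖(((D ⟨coverAt P j x, μ⟩)⁻¹ * C x μ : 𝔸ˣ) : 𝔸) - 1‖ ≤ ρ)
    (hδw : (((2 * (P.d * P.L) + 1) * (P.d * (P.L - 1) + P.L) : ℕ) : ℝ) * p ≤ 1 / 200) (hρw : ρ ≤ 1 / 200)
    (b : PBond P j) (hsrc : blockOf b.src = coverAt P (j + 1) z ∨ blockOf b.src = (⟨coverAt P (j + 1) z, κ⟩ : PBond P (j + 1)).tgt)
    (htgt : blockOf b.tgt = coverAt P (j + 1) z ∨ blockOf b.tgt = (⟨coverAt P (j + 1) z, κ⟩ : PBond P (j + 1)).tgt) :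
    ‖((gaugeAct (fun w => f (blockOf (coverAt P j w))) C ((P.L : ℤ) • z + fun ν => ((b.src ν - coverAt P j ((P.L : ℤ) • z) ν).val : ℤ)) b.dir : 𝔸ˣ) : 𝔸) - 1‖ ≤
        (((2 * (P.d * P.L) + 1) * (P.d * (P.L - 1) + P.L) : ℕ) : ℝ) * p ∧
      ‖((gaugeAct (fun w => f (blockOf (coverAt P j w))) C ((P.L : ℤ) • z + fun ν => ((b.src ν - coverAt P j ((P.L : ℤ) • z) ν).val : ℤ)) b.dir : 𝔸ˣ) : 𝔸) -
          gaugeActT (fun y : Site P j => f (blockOf y)) D b‖ ≤ 102 / 100 * ρ ∧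
      ‖((gaugeActT (fun y : Site P j => f (blockOf y)) D b : 𝔸ˣ) : 𝔸) - 1‖ ≤ (((2 * (P.d * P.L) + 1) * (P.d * (P.L - 1) + P.L) : ℕ) : ℝ) * p + 102 / 100 * ρ := by
  obtain ⟨x, hxs, hxt, hxQ, hxeQ⟩ := lift_twoBlock_bond hj2 z κ b hsrc htgt
  -- the section point of `b̂₋` is the lift `x`
  have hsec : ((P.L : ℤ) • z + fun ν => ((b.src ν - coverAt P j ((P.L : ℤ) • z) ν).val : ℤ)) = x := by
    rw [← hxs]; exact sec_coverAt ((P.L : ℤ) • z) x (window_of_inBox hj2 z x κ hxQ)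
  rw [hsec]
  have hS := norm_pairGauge_sub_one_le hj2 C hCU f hfU z κ hf0 hf1 hp hP hblk x b.dir hxQ hxeQ
  have hHb : ‖(((D b)⁻¹ * C x b.dir : 𝔸ˣ) : 𝔸) - 1‖ ≤ ρ := by have h := hH x b.dir; rw [hxs] at h; exact h
  have hWS := (norm_inv_gaugeActT_mul_gaugeAct_sub_one_le f hfU C D x b hxs hxt).trans hHb
  have h2 := norm_sub_le_of_inv_mul hWS hS hδw hρw
  exact ⟨hS, h2.1, h2.2⟩

end Readings

/-! ## §3 The pair gauge is block-constant -/

section PairGauge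

/-- The block-constant pair gauge read on `ℤᵈ`, `v = f ∘ blockOf ∘ π_j`, is constant on every block: `v(Lw + r) = f(π_{j+1} w)`. [cite: Balaban1987RG1, (0.1)-(0.3) pp.251-252] -/
theorem pairGauge_block {G : Type*} (hj : j + 1 ≤ P.m + P.K) (f : Site P (j + 1) → G) (w : Pt P.d) (r : Fin P.d → Fin P.L) :
    f (blockOf (coverAt P j ((P.L : ℤ) • w + boxVec P.L r))) = f (coverAt P (j + 1) w) := by
  rw [blockOf_coverAt hj, blockMap_smul_add_boxVec (by have := P.hL.2; omega)]

/-- The same at the block corner: `v(Lw) = f(π_{j+1} w)`. [cite: Balaban1987RG1, (0.1)-(0.3) pp.251-252] -/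
theorem pairGauge_corner {G : Type*} (hj : j + 1 ≤ P.m + P.K) (f : Site P (j + 1) → G) (w : Pt P.d) :
    f (blockOf (coverAt P j ((P.L : ℤ) • w))) = f (coverAt P (j + 1) w) := by
  have hL0 : 0 < P.L := by have := P.hL.2; omega
  have h := pairGauge_block hj f w (fun _ => ⟨0, hL0⟩)
  have e0 : boxVec P.L (fun _ : Fin P.d => (⟨0, hL0⟩ : Fin P.L)) = 0 := funext fun i => by simp [boxVec]
  rwa [e0, add_zero] at h

end PairGauge

end Summit.QuantumFields.YangMills.Theorems.HalvingCombStepReadings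

end
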